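/-
Copyright (c) 2026 The HCML crux team. All rights reserved.
Released under Apache 2.0 license as described in the file LICENSE.
Authors: K2E3-p14 (g5) (explicit-unit `hodgecm-mathlib-K2E3-p14-g5`)
-/
import Literature.NumberTheory.Automorphic.GLnLeviQuotientIwasawaIntegration   -- ★ the `GL_n` dischargers (`exists_homeomorph_levi_prod_unipotent_coe_eq`, …); brings ★ `KNAQuotientIntegration`
import Literature.NumberTheory.Automorphic.GLnUnipotentRadicalUnimodular       -- ★ `isInvInvariant_haar_unipotentRadicalGL_of_monotone`
import Literature.NumberTheory.Automorphic.GLnLocalUnimodular                  -- ★ `GLn.isInvInvariant_of_isHaarMeasure_local`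
import HarnessLib

/-!
# (GL-[M6]-sc, VOL brick V1) The `K · U · M` integration formula on `GL_n(F)`: `∫_{GL_n(F)} f = C ∫_K ∫_{U_c} ∫_{M_c} f(k u m)`

Cell `hodgecm-mathlib`, Track B, line `K2_E3_EllipticInputs`; payer «GL-[M6]-sc» of leaf (11-3-split-sc-NE) (dealer K2E3-plan (g3) D63, line lead K2E3-p23
(g5), RULINGS #12 (M12-4) «land the `GL_n` KNA instance as its OWN small file first, in the PARABOLIC generality»).  Harish-Chandra's volume counts for the
non-elliptic tori [HarishChandra1970, Part VII §3 pp. 71–73] are taken in Iwasawa∕parabolic coordinates in the ORDER `z = k · u · m` — `k ∈ K = GL_n(𝒪)`,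
`u ∈ U_c` the unipotent radical, `m ∈ M_c` the standard Levi of a standard parabolic `P_c = M_c U_c` (`c` a monotone block labelling; `c = id`: Borel, `M_c = A`
the diagonal torus, `U_c = N`; `c = (2,1)`: `M_c = GL₂ × GL₁`, `U_c ≅ F²`) — in which `dz = dk du dm` carries NO modulus factor (Gelbart 1975, Thm. 9.22 (iii):
«`dg = da dn dk`»; `G = K·P_c`, `d_r(u m) = du dm`).  The abstract statement is ★ `KNAQuotientIntegration.exists_lintegral_eq_mul_lintegral_KNA` (any
`G = K·B`, `B = A ⋉ N` with `A`, `N`, `G` carrying inversion-invariant Haar measures); every one of its hypotheses is a theorem of the tree at `GL_n(F)` (★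
`isCompact_glInt`, ★ `isClosed_standardParabolicGL`, ★ `exists_homeomorph_levi_prod_unipotent_coe_eq`, ★ `exists_glInt_mul_mem_standardParabolicGL`, ★
`conj_mem_unipotentRadicalGL_of_mem_standardLeviGL`, ★ `GLn.isInvInvariant_of_isHaarMeasure_local`, ★ `isInvInvariant_haar_standardLeviGL`, ★
`isInvInvariant_haar_unipotentRadicalGL_of_monotone`) — exactly the dischargers ★ `exists_quotientMeasure_levi_eq_smul_map` already uses for the QUOTIENT form
`μ_{G⧸M_c} = C • ((k,u) ↦ k u M_c)_*(κ ⊗ μ_U)`.  This file is that one composition, for the GROUP itself: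

* **`GLn.exists_lintegral_eq_mul_lintegral_KUM`** — for a monotone `c` and ANY Haar measures `ν` on `GL_n(F)`, `κ` on `GL_n(𝒪)`, `μU` on `U_c`, `α` on `M_c`:
  ONE constant `C ≠ 0` with `∫⁻_{GL_n(F)} f dν = C · ∫⁻_K ∫⁻_{U_c} ∫⁻_{M_c} f(k u m) dα dμU dκ` for every Borel `f ≥ 0`;
* `GLn.exists_lintegral_eq_mul_lintegral_KNA` — the Borel case `c = id` (`K · N · A`, `A` the diagonal torus), the VOL-split order.

HONEST LABEL: HC_CM is proved only modulo the 7 printed citations (2 remaining named inputs: hLiu418 = stmt-HodgeConjecture-24832, h413 =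
stmt-HodgeConjecture-24833) until rung 0 closes; `GL_n` Haar bookkeeping, count-neutral (kernel lane `--supports stmt-HodgeConjecture-24833 --as helper`),
THEOREMS ONLY — no `def`, no instance, no notation, no `sorry`.

## References
* [Gelbart1975] S. Gelbart, *Automorphic forms on adele groups*, Ann. of Math. Stud. 83 (1975), Thm. 9.22 (iii), Remark 9.23.
* [HarishChandra1970] Harish-Chandra (notes by G. van Dijk), *Harmonic Analysis on Reductive p-adic Groups*, LNM 162 (1970), Part VII §3 pp. 71–73.
* [Folland1995] G. B. Folland, *A Course in Abstract Harmonic Analysis* (1995), §2.6.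
-/

set_option autoImplicit false
set_option linter.dupNamespace false

noncomputable section

open MeasureTheory Measure Topology
open scoped MatrixGroups NNReal ENNReal

namespace Summit.HodgeConjecture.HodgeConjecture.Cruxes.H413.K2E3GLnKNAIntegration

open Literature.MeasureTheory.Group
open Literature.NumberTheory.Automorphic
open Literature.NumberTheory.GaloisRepresentations Literature.NumberTheory.GaloisRepresentations.IsNonarchimedeanLocalField

variable {F : Type*} [Field F] [ValuativeRel F] [TopologicalSpace F] [IsNonarchimedeanLocalField F]
  {n : ℕ} {ι : Type*} [LinearOrder ι] [Fintype ι] {c : Fin n → ι}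
  [MeasurableSpace (GL (Fin n) F)] [BorelSpace (GL (Fin n) F)]

/-- **THE `K · U · M` INTEGRATION FORMULA ON `GL_n(F)`** (Iwasawa∕parabolic coordinates, no modulus factor): for a monotone block labelling `c` and any Haar measures
`ν` on `GL_n(F)`, `κ` on `K = GL_n(𝒪)`, `μU` on the unipotent radical `U_c` and `α` on the standard Levi `M_c`, there is ONE constant `C ≠ 0` with
`∫⁻_{GL_n(F)} f dν = C · ∫⁻_K ∫⁻_{U_c} ∫⁻_{M_c} f(k u m) dα dμU dκ` for every Borel `f : GL_n(F) → [0, ∞]` — ★ `exists_lintegral_eq_mul_lintegral_KNA` with every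
hypothesis discharged by tree theorems (`G = K P_c`, `P_c = M_c ⋉ U_c`, `GL_n(F)`, `M_c`, `U_c` unimodular). [cite: Gelbart1975, Thm. 9.22 (iii)] [cite: Folland1995, §2.6] -/
theorem GLn.exists_lintegral_eq_mul_lintegral_KUM (hc : Monotone c)
    (ν : Measure (GL (Fin n) F)) [IsHaarMeasure ν]
    (κ : Measure ↥(glInt n F)) [IsHaarMeasure κ]
    (μU : Measure ↥(unipotentRadicalGL F c)) [IsHaarMeasure μU]
    (α : Measure ↥(standardLeviGL F c)) [IsHaarMeasure α] :
    ∃ C : ℝ≥0, C ≠ 0 ∧ ∀ f : GL (Fin n) F → ℝ≥0∞, Measurable f →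
      ∫⁻ g, f g ∂ν = C * ∫⁻ k, ∫⁻ u, ∫⁻ m, f ((k : GL (Fin n) F) * (u : GL (Fin n) F) * (m : GL (Fin n) F)) ∂α ∂μU ∂κ := by
  classical
  -- point-set instances on `GL_n(F)` and the three subgroups
  haveI : T2Space F := (isLocalField F).toT2Space
  haveI : SecondCountableTopology F := secondCountableTopology_localField F
  haveI : LocallyCompactSpace F := (isLocalField F).toLocallyCompactSpace
  haveI : IsTopologicalRing F := inferInstance
  haveI : SecondCountableTopology (Matrix (Fin n) (Fin n) F) := inferInstanceAs (SecondCountableTopology (Fin n → Fin n → F))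
  haveI : SecondCountableTopology (Matrix (Fin n) (Fin n) F)ᵐᵒᵖ := MulOpposite.opHomeomorph.symm.secondCountableTopology
  haveI : SecondCountableTopology (GL (Fin n) F) := Units.isEmbedding_embedProduct.secondCountableTopology
  haveI : LocallyCompactSpace (Matrix (Fin n) (Fin n) F) := inferInstanceAs (LocallyCompactSpace (Fin n → Fin n → F))
  haveI : LocallyCompactSpace (GL (Fin n) F) := inferInstance
  haveI : T2Space (GL (Fin n) F) := inferInstance
  haveI : LocallyCompactSpace ↥(standardLeviGL F c) := (isClosed_standardLeviGL (R := F) c).locallyCompactSpace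
  haveI : LocallyCompactSpace ↥(unipotentRadicalGL F c) := (isClosed_unipotentRadicalGL (R := F) c).locallyCompactSpace
  haveI : SecondCountableTopology ↥(standardLeviGL F c) := TopologicalSpace.Subtype.secondCountableTopology _
  haveI : SecondCountableTopology ↥(unipotentRadicalGL F c) := TopologicalSpace.Subtype.secondCountableTopology _
  haveI : SecondCountableTopology ↥(glInt n F) := TopologicalSpace.Subtype.secondCountableTopology _
  haveI : BorelSpace ↥(standardLeviGL F c) := Subtype.borelSpace _
  haveI : BorelSpace ↥(glInt n F) := Subtype.borelSpace _
  haveI : BorelSpace ↥(unipotentRadicalGL F c) := Subtype.borelSpace _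
  haveI : BorelSpace ↥(standardParabolicGL F c) := Subtype.borelSpace _
  haveI : CompactSpace ↥(glInt n F) := isCompact_iff_compactSpace.1 (isCompact_glInt n F)
  haveI : IsFiniteMeasure κ := CompactSpace.isFiniteMeasure
  haveI : SFinite κ := inferInstance
  haveI : SFinite μU := inferInstance
  haveI : SFinite α := inferInstance
  -- the three inversion invariances: `GL_n(F)`, `M_c`, `U_c` are unimodular
  haveI : ν.IsInvInvariant := GLn.isInvInvariant_of_isHaarMeasure_local n F ν
  haveI : α.IsInvInvariant := isInvInvariant_haar_standardLeviGL F c α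
  haveI : μU.IsInvInvariant := isInvInvariant_haar_unipotentRadicalGL_of_monotone F hc μU
  -- `P_c = M_c ⋉ U_c` topologically, `G = K · P_c`
  obtain ⟨e, he⟩ := exists_homeomorph_levi_prod_unipotent_coe_eq F c
  exact exists_lintegral_eq_mul_lintegral_KNA (isCompact_glInt n F) (isClosed_standardParabolicGL F c)
    (standardLeviGL_le F c) (unipotentRadicalGL_le F c)
    (fun a ha u hu => conj_mem_unipotentRadicalGL_of_mem_standardLeviGL c ha hu) e
    (fun p => Subtype.ext (he p)) (exists_glInt_mul_mem_standardParabolicGL hc) ν κ α μU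

/-- **THE `K · N · A` INTEGRATION FORMULA ON `GL_n(F)`** (the Borel case `c = id`: `A = M_id` the diagonal torus, `N = U_id` the upper unitriangular group):
`∫⁻_{GL_n(F)} f dν = C · ∫⁻_K ∫⁻_N ∫⁻_A f(k n a) dα dμN dκ` for every Borel `f ≥ 0`, one `C ≠ 0` — the order in which the split-torus volume count of
Harish-Chandra's Theorem 16 route carries no modulus factor. [cite: Gelbart1975, Thm. 9.22 (iii)] [cite: HarishChandra1970, Part VII §3 p. 72] -/
theorem GLn.exists_lintegral_eq_mul_lintegral_KNA
    (ν : Measure (GL (Fin n) F)) [IsHaarMeasure ν]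
    (κ : Measure ↥(glInt n F)) [IsHaarMeasure κ]
    (μN : Measure ↥(unipotentRadicalGL F (id : Fin n → Fin n))) [IsHaarMeasure μN]
    (α : Measure ↥(standardLeviGL F (id : Fin n → Fin n))) [IsHaarMeasure α] :
    ∃ C : ℝ≥0, C ≠ 0 ∧ ∀ f : GL (Fin n) F → ℝ≥0∞, Measurable f →
      ∫⁻ g, f g ∂ν = C * ∫⁻ k, ∫⁻ u, ∫⁻ a, f ((k : GL (Fin n) F) * (u : GL (Fin n) F) * (a : GL (Fin n) F)) ∂α ∂μN ∂κ :=
  GLn.exists_lintegral_eq_mul_lintegral_KUM monotone_id ν κ μN α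

end Summit.HodgeConjecture.HodgeConjecture.Cruxes.H413.K2E3GLnKNAIntegration

end
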